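import Summits.RiemannHypothesis.RiemannHypothesis.Theorems.WeilTwoPrimeDeflC83XBase
import Literature.NumberTheory.LFunctions.WeilBlockRows
import HarnessLib

/-!
# Deflated two-prime certificate C83X: rows 88–95 of the even check `D C = I`

`WeilCert.checkDCRow 0` for certificate C83X, by `decide +kernel`. Pure proof file.
-/

set_option linter.dupNamespace false

noncomputable section

namespace Summit.RiemannHypothesis.RiemannHypothesis.Theorems.EvenWinsBeyondArch

open Literature.NumberTheory.LFunctions

set_option maxHeartbeats 0 in
/-- Kernel check of row 88 of the even `D C = I` (certificate C83X). [folklore] -/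
theorem checkDCRow0_88_weilCertDeflC83X : weilCertDeflC83XBase.checkDCRow 0 88 = true := by
  decide +kernel

set_option maxHeartbeats 0 in
/-- Kernel check of row 89 of the even `D C = I` (certificate C83X). [folklore] -/
theorem checkDCRow0_89_weilCertDeflC83X : weilCertDeflC83XBase.checkDCRow 0 89 = true := by
  decide +kernel

set_option maxHeartbeats 0 in
/-- Kernel check of row 90 of the even `D C = I` (certificate C83X). [folklore] -/
theorem checkDCRow0_90_weilCertDeflC83X : weilCertDeflC83XBase.checkDCRow 0 90 = true := by
  decide +kernel

set_option maxHeartbeats 0 in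
/-- Kernel check of row 91 of the even `D C = I` (certificate C83X). [folklore] -/
theorem checkDCRow0_91_weilCertDeflC83X : weilCertDeflC83XBase.checkDCRow 0 91 = true := by
  decide +kernel

set_option maxHeartbeats 0 in
/-- Kernel check of row 92 of the even `D C = I` (certificate C83X). [folklore] -/
theorem checkDCRow0_92_weilCertDeflC83X : weilCertDeflC83XBase.checkDCRow 0 92 = true := by
  decide +kernel

set_option maxHeartbeats 0 in
/-- Kernel check of row 93 of the even `D C = I` (certificate C83X). [folklore] -/
theorem checkDCRow0_93_weilCertDeflC83X : weilCertDeflC83XBase.checkDCRow 0 93 = true := by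
  decide +kernel

set_option maxHeartbeats 0 in
/-- Kernel check of row 94 of the even `D C = I` (certificate C83X). [folklore] -/
theorem checkDCRow0_94_weilCertDeflC83X : weilCertDeflC83XBase.checkDCRow 0 94 = true := by
  decide +kernel

set_option maxHeartbeats 0 in
/-- Kernel check of row 95 of the even `D C = I` (certificate C83X). [folklore] -/
theorem checkDCRow0_95_weilCertDeflC83X : weilCertDeflC83XBase.checkDCRow 0 95 = true := by
  decide +kernel


end Summit.RiemannHypothesis.RiemannHypothesis.Theorems.EvenWinsBeyondArch
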